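import Summits.CriticalPhenomena.PercolationContinuityZ3.Theorems.Transplant.SiteMetaA2Defs
import Summits.CriticalPhenomena.PercolationContinuityZ3.Theorems.Transplant.SiteVdBHKCore
import Mathlib.Combinatorics.SetFamily.FourFunctions
import HarnessLib

/-!
# SITE percolation: META-A2 — the generic two-source inequality modulo the one-source bounds (WP4 of P1-SITE-Z3 §12)
# (lane `prim-bschramm`, class C1a; site twin of `CovTau.metaA2_of_star`, with ONE modification)

builds on p205010 (kernel theorem, internal audit signed; external expert review pending).

THEOREM (`SiteCovTau.metaA2_of_star`).  Vertex weights `q ∈ [0,1]` (normalised), owner `x`, observers `o, v`, avoided set `A`, a pure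
world functional `F : Finset V → ℝ` with `F ≥ 0` and `F(U') = 0` whenever `v ∉ U'` or `x ∉ U'`.  If in every sub-world `U' ⊆ U`
  (★^F) `Y_F(N)·M_A(∅) ≤ M_A(N)·F(U')` (`N ⊆ U'`)   and   (anti) `N ↦ Y_F(N)` is antitone,
then for all source sets `N, N' ⊆ U`:   (META-A2)  `E_A(N)·Y_F(N') ≤ M_A(N ∪ N')·X_F(N ∩ N')`.
PROOF = the bond induction (`CovTauMetaA2.lean`): strong induction on `U`; `N ∩ N' = ∅` by (★^F) and the SITE vdBHK Thm 1.1
(`SiteBHK.core`, p208582); `N ∩ N' = Z ≠ ∅` by the site star decompositions at `Z` (`Eav_step`, …, p212128: condition on the STATES of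
`Z`) and the Ahlswede–Daykin four functions theorem over the configuration lattice with the product weight.  THE MODIFICATION (memo §13):
in site percolation the open-neighbour set `S(ω) = sS Γ U Z ω` satisfies only `S(a ∩ b) ⊆ S(a) ∩ S(b)` (not equality; its law is not a
product), and the meet-side functional `X_F` is NOT antitone (exact 4-vertex witness, memo §13(d)); the Ahlswede–Daykin hypothesis is
obtained by applying the induction hypothesis to the SHRUNK pair `P = (S(a) ∖ D) ∪ (N∖Z)∖S(b)`, `P' = S(b) ∪ (N'∖Z)∖(S(a)∖D)` with
`D = (S(a) ∩ S(b)) ∖ S(a ∩ b)`, for which `P ∩ P' = S(a ∩ b)` EXACTLY and `P ∪ P' = (N ∪ N')∖Z ∪ S(a ∪ b)`, using only the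
antitonicity of `E_A` and `Y_F` (which point the right way).
Also `metaP1_of_star`: the diagonal `N = N' = Y` (the shape of (Htw)).
Support file (`--supports stmt-CriticalPhenomena-4575 --as helper`); no definitions, no named facts, no sorries.
[cite: VandenbergHaggstromKahn2005, Thm. 1.1 (pp. 3–5), Thm. 1.3 (p. 6)] [cite: KozmaNitzan2024, Conj. 1 (p. 3)]
-/

noncomputable section

namespace Summit.CriticalPhenomena.PercolationContinuityZ3.Theorems.Transplant

namespace SiteCovTau

open Literature.Probability.Percolation
open Literature.Probability.Percolation.BHK2006 (weight weight_nonneg weight_inter_mul_union)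
open Literature.Probability.Percolation.DecisionTree (ind ind_of_mem ind_of_not_mem ind_nonneg)
open SiteBHK (sC sD sS srest core sS_subset sS_inter_subset sS_union srest_subset)
open scoped Classical

variable {V : Type*} [Fintype V] {Γ : SimpleGraph V}

/-- `Y_F(N) = 0` when `x ∈ N` and the functional vanishes on worlds not containing `x` (on `{x ↮ N}` the source `x` is closed, hence
dead). [folklore] -/
theorem Yw_eq_zero_of_mem (q : V → ℝ) (U : Finset V) (x : V) {F : Finset V → ℝ}
    (hFx : ∀ U' : Finset V, x ∉ U' → F U' = 0) {N : Set V} (hx : x ∈ N) : Yw Γ q U x F N = 0 :=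
  Finset.sum_eq_zero fun ω _ => by
    rw [hFx _ (fun h' => (SiteBHK.mem_srest.1 h').2.1 hx)]; ring

/-- **META-A2 (site) modulo the one-source bounds** — see the module docstring.
[cite: VandenbergHaggstromKahn2005, Thm. 1.1 (pp. 3–5), Thm. 1.3 (p. 6)] -/
theorem metaA2_of_star (q : V → ℝ) (hq0 : ∀ u, 0 ≤ q u) (hq1 : ∀ u, q u ≤ 1)
    (hm : ∑ ω, weight q ω = 1) (x o v : V) (A : Set V) {F : Finset V → ℝ}
    (hF0 : ∀ U' : Finset V, 0 ≤ F U') (hFv : ∀ U' : Finset V, v ∉ U' → F U' = 0)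
    (hFx : ∀ U' : Finset V, x ∉ U' → F U' = 0) (U : Finset V)
    (hstar : ∀ U' ⊆ U, ∀ N : Set V, N ⊆ ↑U' →
      Yw Γ q U' x F N * Mav Γ q U' A v ∅ ≤ Mav Γ q U' A v N * F U')
    (hanti : ∀ U' ⊆ U, ∀ N N' : Set V, N ⊆ N' → N' ⊆ ↑U' → Yw Γ q U' x F N' ≤ Yw Γ q U' x F N) :
    ∀ N N' : Set V, N ⊆ ↑U → N' ⊆ ↑U →
      Eav Γ q U A o v N * Yw Γ q U x F N' ≤ Mav Γ q U A v (N ∪ N') * Xw Γ q U x A o v F (N ∩ N') := by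
  induction U using Finset.strongInduction with
  | H U ih =>
  intro N N' hNU hN'U
  have hRHS : 0 ≤ Mav Γ q U A v (N ∪ N') * Xw Γ q U x A o v F (N ∩ N') :=
    mul_nonneg (Mav_nonneg hq0 hq1 U A v _) (Xw_nonneg hq0 hq1 U x A o v hF0 _)
  -- trivial cases
  by_cases hvN : v ∈ A ∪ N
  · rw [Eav_eq_zero_of_mem q U A o v hvN, zero_mul]; exact hRHS
  have hvN0 : v ∉ N := fun h => hvN (Or.inr h)
  by_cases hxN' : x ∈ N'
  · rw [Yw_eq_zero_of_mem q U x hFx hxN', mul_zero]; exact hRHS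
  by_cases hvU : v ∈ U
  swap
  · rw [Yw_eq_zero_of_not_mem q x hFv hvU, mul_zero]; exact hRHS
  -- `Z := N ∩ N'`
  set Z : Finset V := U.filter fun u => u ∈ N ∧ u ∈ N' with hZ
  have hZU : Z ⊆ U := Finset.filter_subset _ _
  have hmemZ : ∀ u, u ∈ Z ↔ u ∈ N ∧ u ∈ N' := fun u => by
    simp only [hZ, Finset.mem_filter, and_iff_right_iff_imp]
    exact fun h => hNU h.1
  have hxZ : x ∉ Z := fun h => hxN' ((hmemZ x).1 h).2
  have hvZ : v ∉ Z := fun h => hvN0 ((hmemZ v).1 h).1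
  have hZN : (↑Z : Set V) ⊆ N := fun u hu => ((hmemZ u).1 hu).1
  have hZN' : (↑Z : Set V) ⊆ N' := fun u hu => ((hmemZ u).1 hu).2
  have hNN'Z : N ∩ N' = ↑Z := Set.ext fun u => by
    rw [Finset.mem_coe, hmemZ]; rfl
  rcases Z.eq_empty_or_nonempty with hZe | hZne
  · /- `N ∩ N' = ∅`: (★^F) for `N'` and the SITE BHK Thm 1.1 (`SiteBHK.core` with `s = v`, `F = 1`, `G = 1{o ∈ C_v}` on the
    avoided sets `(A ∪ N') ∩ U`, `(A ∪ N) ∩ U`). -/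
    have hNN' : N ∩ N' = ∅ := by rw [hNN'Z, hZe, Finset.coe_empty]
    rw [hNN', Xw_empty q hm]
    have hst := hstar U le_rfl N' hN'U
    have hcore := core (Γ := Γ) q hq0 hq1 hm U v hvU ((A ∪ N') ∩ ↑U) ((A ∪ N) ∩ ↑U)
      Set.inter_subset_right Set.inter_subset_right (fun _ => (1 : ℝ)) (oInd o)
      monotone_const (oInd_mono o) (fun _ => zero_le_one) (oInd_nonneg o)
    have hi : (A ∪ N') ∩ ↑U ∩ ((A ∪ N) ∩ ↑U) = (A ∪ ∅) ∩ ↑U := by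
      ext u
      simp only [Set.mem_inter_iff, Set.mem_union, Set.union_empty, Finset.mem_coe]
      constructor
      · rintro ⟨⟨ha | hn', hu⟩, ha' | hn, -⟩
        · exact ⟨ha, hu⟩
        · exact ⟨ha, hu⟩
        · exact ⟨ha', hu⟩
        · exact absurd hNN' (Set.nonempty_iff_ne_empty.1 ⟨u, hn, hn'⟩)
      · rintro ⟨ha, hu⟩; exact ⟨⟨Or.inl ha, hu⟩, Or.inl ha, hu⟩
    have hu : (A ∪ N') ∩ ↑U ∪ (A ∪ N) ∩ ↑U = (A ∪ (N ∪ N')) ∩ ↑U := by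
      ext u
      simp only [Set.mem_inter_iff, Set.mem_union, Finset.mem_coe]
      tauto
    simp only [one_mul, hi, hu] at hcore
    rw [← Mav_eq_inter q U A v, ← Eav_eq_inter q U A o v, ← Eav_eq_inter q U A o v, ← Mav_eq_inter q U A v] at hcore
    -- hcore : Mav N' * Eav N ≤ Eav ∅ * Mav (N ∪ N')
    have hE := Eav_nonneg hq0 hq1 U A o v N (Γ := Γ)
    have hB := hF0 U
    have hM := Mav_nonneg hq0 hq1 U A v (N ∪ N') (Γ := Γ)
    have hM0 := Mav_nonneg hq0 hq1 U A v (∅ : Set V) (Γ := Γ)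
    have key : Eav Γ q U A o v N * Yw Γ q U x F N' * Mav Γ q U A v ∅ ≤
        Mav Γ q U A v (N ∪ N') * (Eav Γ q U A o v ∅ * F U) :=
      calc Eav Γ q U A o v N * Yw Γ q U x F N' * Mav Γ q U A v ∅
          = Eav Γ q U A o v N * (Yw Γ q U x F N' * Mav Γ q U A v ∅) := by ring
        _ ≤ Eav Γ q U A o v N * (Mav Γ q U A v N' * F U) := mul_le_mul_of_nonneg_left hst hE
        _ = (Mav Γ q U A v N' * Eav Γ q U A o v N) * F U := by ring
        _ ≤ (Eav Γ q U A o v ∅ * Mav Γ q U A v (N ∪ N')) * F U := mul_le_mul_of_nonneg_right hcore hB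
        _ = _ := by ring
    rcases hM0.eq_or_lt with hM0e | hM0p
    · -- `μ(v ↮ A) = 0`: then `E_A(N) = 0`
      have hE0 : Eav Γ q U A o v N = 0 := le_antisymm
        ((Eav_le_Mav hq0 hq1 U A o v N).trans
          ((Mav_antitone hq0 hq1 U A v (Set.empty_subset N)).trans hM0e.symm.le)) hE
      rw [hE0, zero_mul]
      exact mul_nonneg hM (mul_nonneg (qav_nonneg hq0 hq1 U A o v) hB)
    · unfold qav
      calc Eav Γ q U A o v N * Yw Γ q U x F N'
          = Eav Γ q U A o v N * Yw Γ q U x F N' * Mav Γ q U A v ∅ / Mav Γ q U A v ∅ := by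
            field_simp
        _ ≤ Mav Γ q U A v (N ∪ N') * (Eav Γ q U A o v ∅ * F U) / Mav Γ q U A v ∅ :=
            div_le_div_of_nonneg_right key hM0p.le
        _ = Mav Γ q U A v (N ∪ N') * (Eav Γ q U A o v ∅ / Mav Γ q U A v ∅ * F U) := by
            field_simp
  · /- `Z ≠ ∅`: condition on the STATES of `Z` and apply the four functions theorem over the configuration lattice, with the
    induction hypothesis on `U ∖ Z` at the SHRUNK pair. -/
    have hss : U \ Z ⊂ U := Finset.sdiff_ssubset hZU hZne
    have hU'U : U \ Z ⊆ U := Finset.sdiff_subset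
    have hZNN' : (↑Z : Set V) ⊆ N ∪ N' := hZN.trans Set.subset_union_left
    -- star decompositions
    have eE := Eav_step hZU hvZ (A := A) hZN q hm o (Γ := Γ)
    have eY := Yw_step hZU hxZ hZN' q hm F (Γ := Γ)
    have eM := Mav_step hZU hvZ (A := A) hZNN' q hm (Γ := Γ)
    have eX : Xw Γ q U x A o v F (N ∩ N') = ∑ ω, weight q ω * Xw Γ q (U \ Z) x A o v F (sS Γ U Z ω) := by
      rw [hNN'Z, Xw_step hZU hxZ (subset_refl _) q hm A o v F]
      simp only [Set.sdiff_self, Set.empty_union]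
    -- nonnegativity
    have hwn : ∀ ω : Set V, 0 ≤ weight q ω := fun ω => weight_nonneg hq0 hq1 ω
    -- hypotheses restricted to `U ∖ Z`
    have hstar' : ∀ U'' ⊆ (U \ Z), ∀ N : Set V, N ⊆ ↑U'' →
        Yw Γ q U'' x F N * Mav Γ q U'' A v ∅ ≤ Mav Γ q U'' A v N * F U'' :=
      fun U'' hU'' => hstar U'' (hU''.trans hU'U)
    have hanti' : ∀ U'' ⊆ (U \ Z), ∀ N N' : Set V, N ⊆ N' → N' ⊆ ↑U'' →
        Yw Γ q U'' x F N' ≤ Yw Γ q U'' x F N :=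
      fun U'' hU'' => hanti U'' (hU''.trans hU'U)
    have IH := ih (U \ Z) hss hstar' hanti'
    have keyZ : ∀ u, u ∈ N → u ∈ N' → u ∈ (↑Z : Set V) := fun u h1 h2 => (hmemZ u).2 ⟨h1, h2⟩
    rw [eE, eY, eM, eX, mul_comm (∑ ω, weight q ω * Mav Γ q (U \ Z) A v ((N ∪ N') \ ↑Z ∪ sS Γ U Z ω))]
    refine four_functions_theorem_univ
      (fun ω => weight q ω * Eav Γ q (U \ Z) A o v (N \ ↑Z ∪ sS Γ U Z ω))
      (fun ω => weight q ω * Yw Γ q (U \ Z) x F (N' \ ↑Z ∪ sS Γ U Z ω))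
      (fun ω => weight q ω * Xw Γ q (U \ Z) x A o v F (sS Γ U Z ω))
      (fun ω => weight q ω * Mav Γ q (U \ Z) A v ((N ∪ N') \ ↑Z ∪ sS Γ U Z ω))
      (fun ω => mul_nonneg (hwn ω) (Eav_nonneg hq0 hq1 _ A o v _))
      (fun ω => mul_nonneg (hwn ω) (Yw_nonneg hq0 hq1 _ x hF0 _))
      (fun ω => mul_nonneg (hwn ω) (Xw_nonneg hq0 hq1 _ x A o v hF0 _))
      (fun ω => mul_nonneg (hwn ω) (Mav_nonneg hq0 hq1 _ A v _)) fun a b => ?_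
    -- the Ahlswede–Daykin hypothesis from the induction hypothesis at the SHRUNK pair `(P, P')`
    set Sa : Set V := sS Γ U Z a with hSa
    set Sb : Set V := sS Γ U Z b with hSb
    set D : Set V := (Sa ∩ Sb) \ sS Γ U Z (a ∩ b) with hD
    set S' : Set V := Sa \ D with hS'
    set P : Set V := S' ∪ (N \ ↑Z) \ Sb with hP
    set P' : Set V := Sb ∪ (N' \ ↑Z) \ S' with hP'
    have hSaU : Sa ⊆ ↑(U \ Z) := sS_subset U Z a
    have hSbU : Sb ⊆ ↑(U \ Z) := sS_subset U Z b
    have hPU : P ⊆ ↑(U \ Z) := by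
      rintro u (hu | ⟨⟨huN, huZ⟩, -⟩)
      · exact hSaU hu.1
      · rw [Finset.coe_sdiff]; exact ⟨hNU huN, huZ⟩
    have hP'U : P' ⊆ ↑(U \ Z) := by
      rintro u (hu | ⟨⟨huN, huZ⟩, -⟩)
      · exact hSbU hu
      · rw [Finset.coe_sdiff]; exact ⟨hN'U huN, huZ⟩
    have hIH := IH P P' hPU hP'U
    have h1 : Eav Γ q (U \ Z) A o v (N \ ↑Z ∪ Sa) ≤ Eav Γ q (U \ Z) A o v P :=
      Eav_antitone hq0 hq1 (U \ Z) A o v (show P ⊆ N \ ↑Z ∪ Sa from by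
        rintro u (hu | ⟨hu, -⟩); exacts [Or.inr hu.1, Or.inl hu])
    have h2 : Yw Γ q (U \ Z) x F (N' \ ↑Z ∪ Sb) ≤ Yw Γ q (U \ Z) x F P' :=
      hanti (U \ Z) hU'U P' (N' \ ↑Z ∪ Sb) (by rintro u (hu | ⟨hu, -⟩); exacts [Or.inr hu, Or.inl hu])
        (by
          rintro u (⟨huN, huZ⟩ | hu)
          · rw [Finset.coe_sdiff]; exact ⟨hN'U huN, huZ⟩
          · exact hSbU hu)
    have hunion : P ∪ P' = (N ∪ N') \ ↑Z ∪ sS Γ U Z (a ∪ b) := by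
      rw [sS_union]
      ext u
      constructor
      · rintro ((hS | ⟨hA, -⟩) | (hT | ⟨hA', -⟩))
        · exact Or.inr (Or.inl hS.1)
        · exact Or.inl ⟨Or.inl hA.1, hA.2⟩
        · exact Or.inr (Or.inr hT)
        · exact Or.inl ⟨Or.inr hA'.1, hA'.2⟩
      · rintro (⟨hN | hN', hZ'⟩ | (ha | hb))
        · by_cases hT : u ∈ Sb
          · exact Or.inr (Or.inl hT)
          · exact Or.inl (Or.inr ⟨⟨hN, hZ'⟩, hT⟩)
        · by_cases hS : u ∈ S'
          · exact Or.inl (Or.inl hS)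
          · exact Or.inr (Or.inr ⟨⟨hN', hZ'⟩, hS⟩)
        · by_cases hDu : u ∈ D
          · exact Or.inr (Or.inl hDu.1.2)
          · exact Or.inl (Or.inl ⟨ha, hDu⟩)
        · exact Or.inr (Or.inl hb)
    have hinter : P ∩ P' = sS Γ U Z (a ∩ b) := by
      ext u
      constructor
      · rintro ⟨hS | ⟨⟨hN, hZ'⟩, hT⟩, hT' | ⟨⟨hN', -⟩, hS'⟩⟩
        · -- `u ∈ Sa ∖ D` and `u ∈ Sb`: so `u ∈ S(a ∩ b)`
          by_contra hu
          exact hS.2 ⟨⟨hS.1, hT'⟩, hu⟩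
        · exact absurd hS hS'
        · exact absurd hT' hT
        · exact absurd (keyZ u hN hN') hZ'
      · intro hu
        have hab := sS_inter_subset U Z a b hu
        have hnD : u ∉ D := fun h => h.2 hu
        exact ⟨Or.inl ⟨hab.1, hnD⟩, Or.inl hab.2⟩
    have h3 : Eav Γ q (U \ Z) A o v (N \ ↑Z ∪ Sa) * Yw Γ q (U \ Z) x F (N' \ ↑Z ∪ Sb) ≤
        Mav Γ q (U \ Z) A v ((N ∪ N') \ ↑Z ∪ sS Γ U Z (a ∪ b)) * Xw Γ q (U \ Z) x A o v F (sS Γ U Z (a ∩ b)) :=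
      calc Eav Γ q (U \ Z) A o v (N \ ↑Z ∪ Sa) * Yw Γ q (U \ Z) x F (N' \ ↑Z ∪ Sb)
          ≤ Eav Γ q (U \ Z) A o v P * Yw Γ q (U \ Z) x F P' :=
            mul_le_mul h1 h2 (Yw_nonneg hq0 hq1 _ x hF0 _) (Eav_nonneg hq0 hq1 _ A o v _)
        _ ≤ Mav Γ q (U \ Z) A v (P ∪ P') * Xw Γ q (U \ Z) x A o v F (P ∩ P') := hIH
        _ = _ := by rw [hunion, hinter]
    have hwab := weight_inter_mul_union q a b
    show weight q a * Eav Γ q (U \ Z) A o v (N \ ↑Z ∪ Sa) * (weight q b * Yw Γ q (U \ Z) x F (N' \ ↑Z ∪ Sb)) ≤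
      weight q (a ∩ b) * Xw Γ q (U \ Z) x A o v F (sS Γ U Z (a ∩ b)) *
        (weight q (a ∪ b) * Mav Γ q (U \ Z) A v ((N ∪ N') \ ↑Z ∪ sS Γ U Z (a ∪ b)))
    calc weight q a * Eav Γ q (U \ Z) A o v (N \ ↑Z ∪ Sa) * (weight q b * Yw Γ q (U \ Z) x F (N' \ ↑Z ∪ Sb))
        = (weight q a * weight q b) *
          (Eav Γ q (U \ Z) A o v (N \ ↑Z ∪ Sa) * Yw Γ q (U \ Z) x F (N' \ ↑Z ∪ Sb)) := by ring
      _ ≤ (weight q (a ∩ b) * weight q (a ∪ b)) *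
          (Mav Γ q (U \ Z) A v ((N ∪ N') \ ↑Z ∪ sS Γ U Z (a ∪ b)) * Xw Γ q (U \ Z) x A o v F (sS Γ U Z (a ∩ b))) := by
          rw [hwab]
          exact mul_le_mul_of_nonneg_left h3 (mul_nonneg (hwn _) (hwn _))
      _ = _ := by ring

/-- **The diagonal of META-A2 (site) modulo the one-source bounds**: `E_A(Y)·Y_F(Y) ≤ M_A(Y)·X_F(Y)` (the shape of (Htw)).
[cite: VandenbergHaggstromKahn2005, Thm. 1.1 (pp. 3–5)] -/
theorem metaP1_of_star (q : V → ℝ) (hq0 : ∀ u, 0 ≤ q u) (hq1 : ∀ u, q u ≤ 1)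
    (hm : ∑ ω, weight q ω = 1) (x o v : V) (A : Set V) {F : Finset V → ℝ}
    (hF0 : ∀ U' : Finset V, 0 ≤ F U') (hFv : ∀ U' : Finset V, v ∉ U' → F U' = 0)
    (hFx : ∀ U' : Finset V, x ∉ U' → F U' = 0) (U : Finset V) {Y : Set V} (hY : Y ⊆ ↑U)
    (hstar : ∀ U' ⊆ U, ∀ N : Set V, N ⊆ ↑U' →
      Yw Γ q U' x F N * Mav Γ q U' A v ∅ ≤ Mav Γ q U' A v N * F U')
    (hanti : ∀ U' ⊆ U, ∀ N N' : Set V, N ⊆ N' → N' ⊆ ↑U' → Yw Γ q U' x F N' ≤ Yw Γ q U' x F N) :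
    Eav Γ q U A o v Y * Yw Γ q U x F Y ≤ Mav Γ q U A v Y * Xw Γ q U x A o v F Y := by
  have h := metaA2_of_star q hq0 hq1 hm x o v A hF0 hFv hFx U hstar hanti Y Y hY hY
  simpa only [Set.union_self, Set.inter_self] using h

end SiteCovTau

end Summit.CriticalPhenomena.PercolationContinuityZ3.Theorems.Transplant
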